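import Summits.ABC.StewartYu.ArchG3LineSupply
import Summits.ABC.StewartYu.ArchG3StartClosed
import Summits.ABC.StewartYu.SatBasisReduced
import Summits.ABC.StewartYu.SatFrameNotSquare
import Summits.ABC.StewartYu.GenThreeBaseArch
import HarnessLib

/-!
# Cell abc-stewartyu, WP-L.A (crux r2 `ArchCoreRat`, stmt-ABC-20502), line `arch-g3-frame` v4: THE START SUPPLY HOLDS
# (content of the stub `stub_satStartArch`; registrar/lead p4 g10 on lp-1's `archLevelStateQ_zero_closed` and p1/p2/p3's saturation kit)

`Summits/ABC/StewartYu/ArchG3StartSupply.lean` — cell `abc-stewartyu` (HOME `run/shared/lean/pub/abc-stewartyu/`), route `YuMatveevShapeRat`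
(rung A1.L).  Theorems only; no definition, no named fact, no numerics.

`ArchG3Line.startSupply_holds : StartSupply c` for EVERY real `c`: for a reduced pivot-weighted datum `(a, b, A, B, k₀)` under the negated
bound at `c`,
* the saturated basis `θ` with `U, C, N = |det C| ≤ ∏ 2h(aⱼ)/log 2`, `θ^N = a^U`, `a = θ^C`, `UC = CU = N·1`, `q`-saturated for every `q`
  (✓ `SatBasisReduced.exists_reduced_satFrame`), hence with independent square classes (✓ `SatFrameKit.not_isSquare_prod_of_sat`);
* the transported coefficients `b̃ = b ᵥ* C ≠ 0` (✓ `SatFrameKit.vecMul_ne_zero_of_det_ne_zero`) and a pivot `b̃_{j̃₀} ≠ 0`; the set-up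
  `S(θ) := setupOf n θ _ b̃ j̃₀ _` and its saturation datum `F : S.SatData` over the ORIGINAL `(a, b)`;
* the record `P : ArchG3Rec n` ON THE DATUM'S LETTERS: `A`, `A_max := A k₀`, `W := log(eB) ≥ 1` (`B ≥ |b_{k₀}| ≥ 1`), `N`, with
  `N ≤ (2/log 2)ⁿ·Ω` from the kit's index bound and `h(aⱼ) ≤ Aⱼ`;
* the smallness `|Λ̃/b̃_{j̃₀}| ≤ exp(−cⁿ·Ω·W)`: `Λ̃ = Λ` (✓ `SatData.Λ_eq_sum_bo`), `|b̃_{j̃₀}| ≥ 1`, and the negated bound;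
* the level-`(0,0)` state for every direction `(cl, el)` — ✓ `ArchG3Setup.archLevelStateQ_zero_closed` (lp-1; Siegel line (L1) inside).

WHAT THIS IS NOT: not the letter lines / packs (p5's `stub_recLinesArch`); no crux moves by itself.

References: Yu. V. Nesterenko, LNM 1819 (2003), §3.4–3.5 (pp. 66–78), §4.3 Cor. 4.5; E. M. Matveev, Izv. Math. 64 (2000), §3.
-/

noncomputable section

open Finset
open scoped Matrix
open Summit.ABC.StewartYu.ArchG3FrameGlue (setupOf)

namespace Summit.ABC.StewartYu.ArchG3Line

/-- `|Λ| ≤ exp(−X)` from the negated bound `¬(−X ≤ log|Λ|)`. [folklore] -/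
theorem abs_le_exp_neg_of_not_le {Λ X : ℝ} (h : ¬ -X ≤ Real.log |Λ|) : |Λ| ≤ Real.exp (-X) := by
  push Not at h
  by_cases h0 : Λ = 0
  · rw [h0, abs_zero]; exact (Real.exp_pos _).le
  · have hpos : 0 < |Λ| := abs_pos.mpr h0
    rw [← Real.exp_log hpos]
    exact Real.exp_le_exp.mpr h.le

/-- **THE START SUPPLY HOLDS at every constant `c`** (the content of `stub_satStartArch` of the r2 line `arch-g3-frame`, v4).
[cite: Nesterenko2003, §3.4–3.5 Prop. 3.4/3.7/3.9, §4 (4.6), §4.3 Cor. 4.5] -/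
theorem startSupply_holds (c : ℝ) : StartSupply c := by
  classical
  intro n hn a b A B k₀ ha hind hA hA1 hbz _hgcd _hmono hmax hBw hneg _hreg
  -- the reduced saturation frame
  obtain ⟨θ, U, C, N, hθpos, hθind, hsat, -, hNpos, hU, hC, hUC, hCU, hNdet, hNle, -, -, -, -, -⟩ :=
    SatBasisReduced.exists_reduced_satFrame a ha hind
  have hdetC : C.det ≠ 0 := by
    intro h0
    have : (N : ℤ) = 0 := by rw [hNdet, h0, abs_zero]
    have hN0 : N = 0 := by exact_mod_cast this
    omega
  -- transported coefficients and a pivot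
  have hb0 : b ≠ 0 := fun h0 => hbz k₀ (by rw [h0]; rfl)
  have hbt : b ᵥ* C ≠ 0 := SatFrameKit.vecMul_ne_zero_of_det_ne_zero C hdetC hb0
  obtain ⟨jt, hjt⟩ : ∃ j, (b ᵥ* C) j ≠ 0 := Function.ne_iff.mp hbt
  -- the saturation datum over the original `(a, b)`
  let F : (setupOf n θ hθpos (b ᵥ* C) jt hjt).SatData :=
    { αo := a, hαo := ha, U := U, C := C, N := N, hN := hNpos, hU := hU, hC := hC, hUC := hUC, hCU := hCU, bo := b, hb := rfl }
  have hdet' : F.C.det.natAbs = F.N := by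
    have h1 : ((C.det.natAbs : ℕ) : ℤ) = (N : ℤ) := by rw [Int.natCast_natAbs, ← hNdet]
    exact_mod_cast h1
  -- the record on the datum's letters
  have hAk : 0 < A k₀ := lt_of_lt_of_le one_pos (hA1 k₀)
  have hB1 : 1 ≤ B := by
    have h1 := hBw k₀
    have h2 : (1 : ℝ) ≤ |(b k₀ : ℝ)| := by
      have : (1 : ℤ) ≤ |b k₀| := Int.one_le_abs (hbz k₀)
      exact_mod_cast this
    nlinarith
  have hW1 : 1 ≤ Real.log (Real.exp 1 * B) := by
    rw [Real.log_mul (Real.exp_pos 1).ne' (by linarith), Real.log_exp]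
    linarith [Real.log_nonneg hB1]
  have hΩ1 : ∀ j, (1 : ℝ) ≤ A j := hA1
  have hAmaxΩ : A k₀ ≤ ∏ j, A j := by
    rw [← Finset.mul_prod_erase univ A (mem_univ k₀)]
    exact le_mul_of_one_le_right hAk.le (Finset.one_le_prod fun j _ => hA1 j)
  have hNΩ : (N : ℝ) ≤ (2 / Real.log 2) ^ n * ∏ j, A j := by
    have hl : 0 < Real.log 2 := Real.log_pos one_lt_two
    calc (N : ℝ) ≤ ∏ j, (2 * Height.logHeight₁ (a j) / Real.log 2) := hNle
      _ ≤ ∏ j, (2 / Real.log 2 * A j) :=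
          prod_le_prod (fun j _ => by have := Height.zero_le_logHeight₁ (a j); positivity) fun j _ => by
            rw [div_mul_eq_mul_div, mul_div_assoc, mul_div_assoc]
            exact mul_le_mul_of_nonneg_left (div_le_div_of_nonneg_right (hA j) hl.le) (by norm_num)
      _ = (2 / Real.log 2) ^ n * ∏ j, A j := by
          rw [prod_mul_distrib, prod_const, Finset.card_univ, Fintype.card_fin]
  let P : ArchG3Rec n :=
    { A := A, Amax := A k₀, W := Real.log (Real.exp 1 * B), N := N, hn := by omega, hA := hA1, hAmax := hmax, hW := hW1,
      hN := hNpos, hNΩ := hNΩ, hAmaxΩ := hAmaxΩ }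
  -- heights dominate logarithms
  have hAo : ∀ j, |Real.log (F.αo j : ℝ)| ≤ P.A j := fun j => GenThreeBaseArch.abs_log_le_weight (ha j) (hA j)
  -- the smallness: `Λ̃ = Λ`, `|b̃_{j̃₀}| ≥ 1`
  have hΛ : |(setupOf n θ hθpos (b ᵥ* C) jt hjt).Λ / ((b ᵥ* C) jt : ℝ)| ≤ Real.exp (-(c ^ n * P.Ω * P.W)) := by
    have e1 : (setupOf n θ hθpos (b ᵥ* C) jt hjt).Λ = ∑ j, (b j : ℝ) * Real.log (a j : ℝ) := F.Λ_eq_sum_bo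
    have h1 : |∑ j, (b j : ℝ) * Real.log (a j : ℝ)| ≤ Real.exp (-(c ^ n * P.Ω * P.W)) :=
      abs_le_exp_neg_of_not_le hneg
    have h2 : (1 : ℝ) ≤ |((b ᵥ* C) jt : ℝ)| := by
      have : (1 : ℤ) ≤ |(b ᵥ* C) jt| := Int.one_le_abs hjt
      exact_mod_cast this
    rw [abs_div, e1]
    exact (div_le_self (abs_nonneg _) h2).trans h1
  refine ⟨θ, hθpos, b ᵥ* C, jt, hjt, F, P, rfl, rfl, rfl, rfl, hdet', rfl,
    SatFrameKit.not_isSquare_prod_of_sat θ hθpos hθind hsat, hΛ, fun cl el hc0 he0 => ?_⟩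
  exact ArchG3Setup.archLevelStateQ_zero_closed F P rfl hdet' hAo cl el hc0 he0

/-- **The r2 line's START stub, by name**: `∃ c₀, ∀ c ≥ c₀, StartSupply c` (any floor; here `c₀ = 0`). [cite: Nesterenko2003, §3.5; shape only] -/
theorem startSupply_stub : ∃ c₀ : ℝ, ∀ c : ℝ, c₀ ≤ c → StartSupply c := ⟨0, fun c _ => startSupply_holds c⟩

end Summit.ABC.StewartYu.ArchG3Line

end
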